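import Literature.NumberTheory.LFunctions.YoshidaWindowGramFrontDoorJ
import HarnessLib

/-!
# Kernel enclosures of Yoshida's matrix coefficients — VII-d: the order-`J` tails in FACTORED form `Σ_r φ_r ψ_rᵀ + diag`

Source: H. Yoshida, Adv. Stud. Pure Math. **21** (1992) 281–325, §§5–7 [Yoshida1992HermitianForms]; R. E. Moore,
*Interval Analysis* (1966), Ch. 3 [Moore1966] (inclusion property).

The column-band kit (`Summits/…/WeilFormatCDataKitCB.lean`, rh-explicit weil-2) takes a tail matrix `U₂` through its
majorant premise AND a factorisation `U₂(i,i') = Σ_{r<R} φ(i,r)·ψ(i',r) + [i=i']·dg(i)`, so that the Schur step costs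
`R` integer products per entry on certified factor data instead of one box evaluation of `U₂(i,i')`.  Parts VII-a/b
(`YoshidaWindowGramTailJ`, `…TailJBox`, `…FrontDoorJ`) give the order-`J` tails `U2EvenJ` / `U2OddJ` in structured form
(`U2EvenJ'`: `cA·Σ_{j,j'} H^A_{jj'} v^A_j(i)v^A_{j'}(i') + cB·Σ_{r,r'} H^B_{rr'} v^B_r(i)v^B_{r'}(i') + [i=i']·cR·ρ_i²`) with
boxes of every atom.  Here, with `R = J + J`:

* `Encl.phiJe a J i r` = `v^A_r(i)` (`r < J`) resp. `v^B_{r−J}(i)`; `Encl.psiJe … i' r` = `cA·Σ_{j'} H^A_{r j'} v^A_{j'}(i')`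
  resp. `cB·Σ_{r'} H^B_{(r−J) r'} v^B_{r'}(i')`; `Encl.dgJe … i = cR·ρ_i²`; `Encl.U2EvenJ_eq_factored`;
* the odd analogues `phiJo`, `psiJo`, `dgJo`, `U2OddJ_eq_factored`;
* boxes `phiJeBox`, `psiJeBox`, `dgJeBox` (+ odd) from the atoms' boxes, with `mem` lemmas (records of the block modes from
  the full table: mode `i` even, `k + 1` odd).

`θ = θn/θd`, `η = ηn/ηd`, `d₀ = d0z·2^{−cd}` as in `u2EvenJBox`.  Everything is proved; no named facts.
-/

open Real Complex Finset Matrix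
open scoped BigOperators

namespace Literature.NumberTheory.LFunctions.Yoshida1992

open Literature.Analysis.SpecialFunctions Literature.Analysis.ValidatedNumerics.NumericsMP
open Literature.Analysis.ValidatedNumerics
open scoped ArithmeticFunction.vonMangoldt

namespace Encl

variable {S : ℕ} {a : ℝ} {ks : List PrimeLen} {C : Consts}

/-! ## Even sector -/

/-- Left factors: `v^A_r(i)` for `r < J`, `v^B_{r−J}(i)` for `J ≤ r`. [cite: Yoshida1992HermitianForms, §7 pp. 305–312] -/
noncomputable def phiJe (a : ℝ) (Je i r : ℕ) : ℝ := if r < Je then vAe i r else vBe a i (r - Je)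

/-- Right factors: `cA·(H^A v^A(i'))_r` for `r < J`, `cB·(H^B v^B(i'))_{r−J}` for `J ≤ r`.
[cite: Yoshida1992HermitianForms, §7 pp. 305–312] -/
noncomputable def psiJe (a θ η d0 : ℝ) (Be B3e Je i' r : ℕ) : ℝ :=
  if r < Je then
    (1 + θ) * (1 + η) * (cAe a B3e ^ 2 / (π ^ 2 * d0)) *
      ∑ j' ∈ Finset.range Je, hankH pA (B3e - 1) B3e Be Je r j' * vAe i' j'
  else
    (1 + θ) * (1 + η⁻¹) * (1 / d0) *
      ∑ r' ∈ Finset.range Je, hankH pB (B3e - 1) B3e Be Je (r - Je) r' * vBe a i' r'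

/-- Diagonal: `(1+θ⁻¹)·(B/(d₀(4J+1)(B₃−1)^{4J+1}))·ρ_i²`. [cite: Yoshida1992HermitianForms, §7 pp. 305–312] -/
noncomputable def dgJe (a θ d0 : ℝ) (Be B3e Je i : ℕ) : ℝ :=
  (1 + θ⁻¹) * ((Be : ℝ) / (d0 * ((4 * Je + 1 : ℕ) * (((B3e - 1 : ℕ) : ℝ)) ^ (4 * Je + 1)))) * rhoE a Je i ^ 2

/-- **`U₂⁺ = Σ_{r<2J} φ_r ψ_rᵀ + diag`.** [cite: Yoshida1992HermitianForms, §7 pp. 305–312] -/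
theorem U2EvenJ_eq_factored (a θ η d0 : ℝ) (Be B3e Je i i' : ℕ) :
    U2EvenJ a θ η d0 Be B3e Je i i'
      = (∑ r ∈ Finset.range (Je + Je), phiJe a Je i r * psiJe a θ η d0 Be B3e Je i' r)
        + (if i = i' then dgJe a θ d0 Be B3e Je i else 0) := by
  rw [← U2EvenJ'_eq, Finset.sum_range_add]
  unfold U2EvenJ' phiJe psiJe dgJe
  have hA : ∀ r ∈ Finset.range Je, (if r < Je then vAe i r else vBe a i (r - Je)) *
      (if r < Je then (1 + θ) * (1 + η) * (cAe a B3e ^ 2 / (π ^ 2 * d0)) *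
          ∑ j' ∈ Finset.range Je, hankH pA (B3e - 1) B3e Be Je r j' * vAe i' j'
        else (1 + θ) * (1 + η⁻¹) * (1 / d0) *
          ∑ r' ∈ Finset.range Je, hankH pB (B3e - 1) B3e Be Je (r - Je) r' * vBe a i' r')
      = (1 + θ) * (1 + η) * (cAe a B3e ^ 2 / (π ^ 2 * d0)) *
          ∑ j' ∈ Finset.range Je, hankH pA (B3e - 1) B3e Be Je r j' * vAe i r * vAe i' j' := by
    intro r hr
    rw [if_pos (Finset.mem_range.mp hr), if_pos (Finset.mem_range.mp hr), Finset.mul_sum, Finset.mul_sum, Finset.mul_sum]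
    exact Finset.sum_congr rfl fun j' _ ↦ by ring
  have hB : ∀ r ∈ Finset.range Je, (if Je + r < Je then vAe i (Je + r) else vBe a i (Je + r - Je)) *
      (if Je + r < Je then (1 + θ) * (1 + η) * (cAe a B3e ^ 2 / (π ^ 2 * d0)) *
          ∑ j' ∈ Finset.range Je, hankH pA (B3e - 1) B3e Be Je (Je + r) j' * vAe i' j'
        else (1 + θ) * (1 + η⁻¹) * (1 / d0) *
          ∑ r' ∈ Finset.range Je, hankH pB (B3e - 1) B3e Be Je (Je + r - Je) r' * vBe a i' r')
      = (1 + θ) * (1 + η⁻¹) * (1 / d0) *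
          ∑ r' ∈ Finset.range Je, hankH pB (B3e - 1) B3e Be Je r r' * vBe a i r * vBe a i' r' := by
    intro r _
    rw [if_neg (by omega), if_neg (by omega), Nat.add_sub_cancel_left, Finset.mul_sum, Finset.mul_sum, Finset.mul_sum]
    exact Finset.sum_congr rfl fun r' _ ↦ by ring
  rw [Finset.sum_congr rfl hA, Finset.sum_congr rfl hB, ← Finset.mul_sum, ← Finset.mul_sum]

/-- Box of `φ⁺_r(i)` (record of mode `i`). [cite: Moore1966, Ch. 3 (interval arithmetic: inclusion property)] -/
def phiJeBox (S : ℕ) (C : Consts) (F : FDConsts) (R : IdxRec) (Je i r : ℕ) : MI :=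
  if r < Je then vAeBox S i r else vBeBox S C F R i (r - Je)

/-- [cite: Moore1966, Ch. 3 (interval arithmetic: inclusion property)] -/
theorem mem_phiJeBox (hS : 0 < S) (hks : PrimeData a ks) (hC : ConstsValid S a ks C) {F : FDConsts}
    (hF : FDValid S a F) {i r Je : ℕ} {R : IdxRec} (hR : OffValid S a ks (i : ℤ) R) :
    MI.mem S (phiJe a Je i r) (phiJeBox S C F R Je i r) := by
  unfold phiJe phiJeBox
  split_ifs
  · exact mem_vAeBox S i r
  · exact mem_vBeBox hS hks hC hF hR

/-- Box of `ψ⁺_r(i')` (record of mode `i'`). [cite: Moore1966, Ch. 3 (interval arithmetic: inclusion property)] -/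
def psiJeBox (S : ℕ) (C : Consts) (F : FDConsts) (R : IdxRec) (cd d0z Be B3e Je θn θd ηn ηd : ℕ) (i' r : ℕ) : MI :=
  if r < Je then
    (((((cAeBox S C F B3e).sqr S).mul S F.invPi2).mulInt (((θd + θn) * (ηd + ηn) * 2 ^ cd : ℕ) : ℤ)).divNat
      (θd * ηd * d0z)).mul S
      (sumBox S (fun j' ↦ (hankHBox S pA (B3e - 1) B3e Be Je r j').mul S (vAeBox S i' j')) Je)
  else
    (((MI.ofInt S 1).mulInt (((θd + θn) * (ηn + ηd) * 2 ^ cd : ℕ) : ℤ)).divNat (θd * ηn * d0z)).mul S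
      (sumBox S (fun r' ↦ (hankHBox S pB (B3e - 1) B3e Be Je (r - Je) r').mul S (vBeBox S C F R i' r')) Je)

/-- [cite: Moore1966, Ch. 3 (interval arithmetic: inclusion property)] -/
theorem mem_psiJeBox (hS : 0 < S) (hks : PrimeData a ks) (hC : ConstsValid S a ks C) {F : FDConsts}
    (hF : FDValid S a F) {cd d0z Be B3e Je θn θd ηn ηd : ℕ} (hd0 : 0 < d0z) (hθn : 0 < θn) (hθd : 0 < θd)
    (hηn : 0 < ηn) (hηd : 0 < ηd) (hBe : 0 < Be) (hB3 : 2 ≤ B3e) {i' r : ℕ} {R : IdxRec}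
    (hR : OffValid S a ks (i' : ℤ) R) :
    MI.mem S (psiJe a ((θn : ℝ) / θd) ((ηn : ℝ) / ηd) ((d0z : ℝ) * (1 / 2 ^ cd)) Be B3e Je i' r)
      (psiJeBox S C F R cd d0z Be B3e Je θn θd ηn ηd i' r) := by
  have hX : 0 < B3e - 1 := by omega
  have hπ : (π : ℝ) ≠ 0 := Real.pi_ne_zero
  have hθd' : (θd : ℝ) ≠ 0 := by exact_mod_cast hθd.ne'
  have hθn' : (θn : ℝ) ≠ 0 := by exact_mod_cast hθn.ne'
  have hηd' : (ηd : ℝ) ≠ 0 := by exact_mod_cast hηd.ne'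
  have hηn' : (ηn : ℝ) ≠ 0 := by exact_mod_cast hηn.ne'
  have hd0' : (d0z : ℝ) ≠ 0 := by exact_mod_cast hd0.ne'
  have h2 : (2 : ℝ) ^ cd ≠ 0 := by positivity
  have hpA : ∀ j, 1 ≤ pA j := fun j ↦ by simp [pA]
  have hpB : ∀ j, 1 ≤ pB j := fun j ↦ by simp [pB]
  have hcA : MI.mem S ((1 + (θn : ℝ) / θd) * (1 + (ηn : ℝ) / ηd) * (cAe a B3e ^ 2 / (π ^ 2 * ((d0z : ℝ) * (1 / 2 ^ cd)))))
      (((((cAeBox S C F B3e).sqr S).mul S F.invPi2).mulInt (((θd + θn) * (ηd + ηn) * 2 ^ cd : ℕ) : ℤ)).divNat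
        (θd * ηd * d0z)) := by
    have h := MI.mem_divNat (MI.mem_mulInt (MI.mem_mul hS (MI.mem_sqr hS (mem_cAeBox hS hC hF (B3e := B3e) (by omega)))
      hF.invPi2) (((θd + θn) * (ηd + ηn) * 2 ^ cd : ℕ) : ℤ)) (n := θd * ηd * d0z) (by positivity)
    refine mem_of_eq h ?_
    push_cast
    field_simp
  have hcB : MI.mem S ((1 + (θn : ℝ) / θd) * (1 + ((ηn : ℝ) / ηd)⁻¹) * (1 / ((d0z : ℝ) * (1 / 2 ^ cd))))
      (((MI.ofInt S 1).mulInt (((θd + θn) * (ηn + ηd) * 2 ^ cd : ℕ) : ℤ)).divNat (θd * ηn * d0z)) := by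
    have h := MI.mem_divNat (MI.mem_mulInt (MI.mem_ofInt S 1) (((θd + θn) * (ηn + ηd) * 2 ^ cd : ℕ) : ℤ))
      (n := θd * ηn * d0z) (by positivity)
    refine mem_of_eq h ?_
    push_cast
    field_simp
  unfold psiJe psiJeBox
  split_ifs
  · exact MI.mem_mul hS hcA (mem_sumBox S Je fun j' _ ↦
      MI.mem_mul hS (mem_hankHBox S hpA hX (by omega) hBe r j') (mem_vAeBox S i' j'))
  · exact MI.mem_mul hS hcB (mem_sumBox S Je fun r' _ ↦
      MI.mem_mul hS (mem_hankHBox S hpB hX (by omega) hBe (r - Je) r') (mem_vBeBox hS hks hC hF hR))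

/-- Box of the diagonal `dg⁺(i)` (record of mode `i`). [cite: Moore1966, Ch. 3 (interval arithmetic: inclusion property)] -/
def dgJeBox (S : ℕ) (C : Consts) (F : FDConsts) (R : IdxRec) (cd d0z Be B3e Je θn θd : ℕ) (i : ℕ) : MI :=
  (((MI.ofInt S 1).mulInt (((θn + θd) * Be * 2 ^ cd : ℕ) : ℤ)).divNat
      (θn * d0z * (4 * Je + 1) * (B3e - 1) ^ (4 * Je + 1))).mul S ((rhoEBox S C F R Je i).sqr S)

/-- [cite: Moore1966, Ch. 3 (interval arithmetic: inclusion property)] -/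
theorem mem_dgJeBox (hS : 0 < S) (hC : ConstsValid S a ks C) {F : FDConsts} (hF : FDValid S a F)
    {cd d0z Be B3e Je θn θd : ℕ} (hd0 : 0 < d0z) (hθn : 0 < θn) (hθd : 0 < θd) (hB3 : 2 ≤ B3e) {i : ℕ} {R : IdxRec}
    (hR : OffValid S a ks (i : ℤ) R) :
    MI.mem S (dgJe a ((θn : ℝ) / θd) ((d0z : ℝ) * (1 / 2 ^ cd)) Be B3e Je i)
      (dgJeBox S C F R cd d0z Be B3e Je θn θd i) := by
  have hX : 0 < B3e - 1 := by omega
  have hθd' : (θd : ℝ) ≠ 0 := by exact_mod_cast hθd.ne'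
  have hθn' : (θn : ℝ) ≠ 0 := by exact_mod_cast hθn.ne'
  have hd0' : (d0z : ℝ) ≠ 0 := by exact_mod_cast hd0.ne'
  have h2 : (2 : ℝ) ^ cd ≠ 0 := by positivity
  have hcR : MI.mem S ((1 + ((θn : ℝ) / θd)⁻¹) * ((Be : ℝ) / ((d0z : ℝ) * (1 / 2 ^ cd) *
      ((4 * Je + 1 : ℕ) * (((B3e - 1 : ℕ) : ℝ)) ^ (4 * Je + 1)))))
      (((MI.ofInt S 1).mulInt (((θn + θd) * Be * 2 ^ cd : ℕ) : ℤ)).divNat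
        (θn * d0z * (4 * Je + 1) * (B3e - 1) ^ (4 * Je + 1))) := by
    have h := MI.mem_divNat (MI.mem_mulInt (MI.mem_ofInt S 1) (((θn + θd) * Be * 2 ^ cd : ℕ) : ℤ))
      (n := θn * d0z * (4 * Je + 1) * (B3e - 1) ^ (4 * Je + 1)) (by positivity)
    refine mem_of_eq h ?_
    have hX' : (((B3e - 1 : ℕ) : ℝ)) ≠ 0 := by exact_mod_cast hX.ne'
    push_cast
    field_simp
  unfold dgJe dgJeBox
  exact MI.mem_mul hS hcR (MI.mem_sqr hS (mem_rhoEBox hS hC hF hR))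

/-- `U₂⁺` is symmetric. [cite: Yoshida1992HermitianForms, §7 pp. 305–312] -/
theorem hankH_comm (p : ℕ → ℕ) (X Y B Je j j' : ℕ) (h : j ≠ j') : hankH p X Y B Je j j' = hankH p X Y B Je j' j := by
  unfold hankH
  rw [if_neg h, if_neg (Ne.symm h), Nat.add_comm (p j) (p j')]

/-- `U₂⁺(i,i') = U₂⁺(i',i)`. [cite: Yoshida1992HermitianForms, §7 pp. 305–312] -/
theorem U2EvenJ_comm (a θ η d0 : ℝ) (Be B3e Je i i' : ℕ) :
    U2EvenJ a θ η d0 Be B3e Je i i' = U2EvenJ a θ η d0 Be B3e Je i' i := by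
  rw [← U2EvenJ'_eq, ← U2EvenJ'_eq]
  unfold U2EvenJ'
  have hsA : ∑ j ∈ Finset.range Je, ∑ j' ∈ Finset.range Je, hankH pA (B3e - 1) B3e Be Je j j' * vAe i j * vAe i' j'
      = ∑ j ∈ Finset.range Je, ∑ j' ∈ Finset.range Je, hankH pA (B3e - 1) B3e Be Je j j' * vAe i' j * vAe i j' := by
    rw [Finset.sum_comm]
    refine Finset.sum_congr rfl fun j _ ↦ Finset.sum_congr rfl fun j' _ ↦ ?_
    by_cases hjj : j' = j
    · subst hjj; ring
    · rw [hankH_comm _ _ _ _ _ _ _ hjj]; ring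
  have hsB : ∑ r ∈ Finset.range Je, ∑ r' ∈ Finset.range Je, hankH pB (B3e - 1) B3e Be Je r r' * vBe a i r * vBe a i' r'
      = ∑ r ∈ Finset.range Je, ∑ r' ∈ Finset.range Je, hankH pB (B3e - 1) B3e Be Je r r' * vBe a i' r * vBe a i r' := by
    rw [Finset.sum_comm]
    refine Finset.sum_congr rfl fun r _ ↦ Finset.sum_congr rfl fun r' _ ↦ ?_
    by_cases hrr : r' = r
    · subst hrr; ring
    · rw [hankH_comm _ _ _ _ _ _ _ hrr]; ring
  rw [hsA, hsB]
  by_cases hii : i = i'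
  · subst hii; rfl
  · rw [if_neg hii, if_neg (Ne.symm hii)]

/-! ## Odd sector -/

/-- Left factors (odd): `v^A_r(k)` for `r < J`, `v^B_{r−J}(k)` for `J ≤ r`. [cite: Yoshida1992HermitianForms, §7 pp. 305–312] -/
noncomputable def phiJo (a : ℝ) (Jo k r : ℕ) : ℝ := if r < Jo then vAo k r else vBo a k (r - Jo)

/-- Right factors (odd). [cite: Yoshida1992HermitianForms, §7 pp. 305–312] -/
noncomputable def psiJo (a θ η d0 : ℝ) (Bo B3o Jo k' r : ℕ) : ℝ :=
  if r < Jo then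
    (1 + θ) * (1 + η) * (cAo a B3o ^ 2 / (π ^ 2 * d0)) *
      ∑ j' ∈ Finset.range Jo, hankH pOA B3o (B3o + 1) Bo Jo r j' * vAo k' j'
  else
    (1 + θ) * (1 + η⁻¹) * (1 / d0) *
      ∑ r' ∈ Finset.range Jo, hankH pOB B3o (B3o + 1) Bo Jo (r - Jo) r' * vBo a k' r'

/-- Diagonal (odd): `(1+θ⁻¹)·(B/(d₀(4J+1)B₃^{4J+1}))·ρ⁻_k²`. [cite: Yoshida1992HermitianForms, §7 pp. 305–312] -/
noncomputable def dgJo (a θ d0 : ℝ) (Bo B3o Jo k : ℕ) : ℝ :=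
  (1 + θ⁻¹) * ((Bo : ℝ) / (d0 * ((4 * Jo + 1 : ℕ) * (B3o : ℝ) ^ (4 * Jo + 1)))) * rhoO a Jo k ^ 2

/-- **`U₂⁻ = Σ_{r<2J} φ_r ψ_rᵀ + diag`.** [cite: Yoshida1992HermitianForms, §7 pp. 305–312] -/
theorem U2OddJ_eq_factored (a θ η d0 : ℝ) (Bo B3o Jo k k' : ℕ) :
    U2OddJ a θ η d0 Bo B3o Jo k k'
      = (∑ r ∈ Finset.range (Jo + Jo), phiJo a Jo k r * psiJo a θ η d0 Bo B3o Jo k' r)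
        + (if k = k' then dgJo a θ d0 Bo B3o Jo k else 0) := by
  rw [← U2OddJ'_eq, Finset.sum_range_add]
  unfold U2OddJ' phiJo psiJo dgJo
  have hA : ∀ r ∈ Finset.range Jo, (if r < Jo then vAo k r else vBo a k (r - Jo)) *
      (if r < Jo then (1 + θ) * (1 + η) * (cAo a B3o ^ 2 / (π ^ 2 * d0)) *
          ∑ j' ∈ Finset.range Jo, hankH pOA B3o (B3o + 1) Bo Jo r j' * vAo k' j'
        else (1 + θ) * (1 + η⁻¹) * (1 / d0) *
          ∑ r' ∈ Finset.range Jo, hankH pOB B3o (B3o + 1) Bo Jo (r - Jo) r' * vBo a k' r')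
      = (1 + θ) * (1 + η) * (cAo a B3o ^ 2 / (π ^ 2 * d0)) *
          ∑ j' ∈ Finset.range Jo, hankH pOA B3o (B3o + 1) Bo Jo r j' * vAo k r * vAo k' j' := by
    intro r hr
    rw [if_pos (Finset.mem_range.mp hr), if_pos (Finset.mem_range.mp hr), Finset.mul_sum, Finset.mul_sum, Finset.mul_sum]
    exact Finset.sum_congr rfl fun j' _ ↦ by ring
  have hB : ∀ r ∈ Finset.range Jo, (if Jo + r < Jo then vAo k (Jo + r) else vBo a k (Jo + r - Jo)) *
      (if Jo + r < Jo then (1 + θ) * (1 + η) * (cAo a B3o ^ 2 / (π ^ 2 * d0)) *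
          ∑ j' ∈ Finset.range Jo, hankH pOA B3o (B3o + 1) Bo Jo (Jo + r) j' * vAo k' j'
        else (1 + θ) * (1 + η⁻¹) * (1 / d0) *
          ∑ r' ∈ Finset.range Jo, hankH pOB B3o (B3o + 1) Bo Jo (Jo + r - Jo) r' * vBo a k' r')
      = (1 + θ) * (1 + η⁻¹) * (1 / d0) *
          ∑ r' ∈ Finset.range Jo, hankH pOB B3o (B3o + 1) Bo Jo r r' * vBo a k r * vBo a k' r' := by
    intro r _
    rw [if_neg (by omega), if_neg (by omega), Nat.add_sub_cancel_left, Finset.mul_sum, Finset.mul_sum, Finset.mul_sum]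
    exact Finset.sum_congr rfl fun r' _ ↦ by ring
  rw [Finset.sum_congr rfl hA, Finset.sum_congr rfl hB, ← Finset.mul_sum, ← Finset.mul_sum]

/-- Box of `φ⁻_r(k)` (record of mode `k + 1`). [cite: Moore1966, Ch. 3 (interval arithmetic: inclusion property)] -/
def phiJoBox (S : ℕ) (C : Consts) (F : FDConsts) (R : IdxRec) (Jo k r : ℕ) : MI :=
  if r < Jo then vAoBox S k r else vBoBox S C F R k (r - Jo)

/-- [cite: Moore1966, Ch. 3 (interval arithmetic: inclusion property)] -/
theorem mem_phiJoBox (hS : 0 < S) (hks : PrimeData a ks) (hC : ConstsValid S a ks C) {F : FDConsts}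
    (hF : FDValid S a F) {k r Jo : ℕ} {R : IdxRec} (hR : OffValid S a ks ((k : ℤ) + 1) R) :
    MI.mem S (phiJo a Jo k r) (phiJoBox S C F R Jo k r) := by
  unfold phiJo phiJoBox
  split_ifs
  · exact mem_vAoBox S k r
  · exact mem_vBoBox hS hks hC hF hR

/-- Box of `ψ⁻_r(k')` (record of mode `k' + 1`). [cite: Moore1966, Ch. 3 (interval arithmetic: inclusion property)] -/
def psiJoBox (S : ℕ) (C : Consts) (F : FDConsts) (R : IdxRec) (cd d0z Bo B3o Jo θn θd ηn ηd : ℕ) (k' r : ℕ) : MI :=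
  if r < Jo then
    (((((cAoBox S C F B3o).sqr S).mul S F.invPi2).mulInt (((θd + θn) * (ηd + ηn) * 2 ^ cd : ℕ) : ℤ)).divNat
      (θd * ηd * d0z)).mul S
      (sumBox S (fun j' ↦ (hankHBox S pOA B3o (B3o + 1) Bo Jo r j').mul S (vAoBox S k' j')) Jo)
  else
    (((MI.ofInt S 1).mulInt (((θd + θn) * (ηn + ηd) * 2 ^ cd : ℕ) : ℤ)).divNat (θd * ηn * d0z)).mul S
      (sumBox S (fun r' ↦ (hankHBox S pOB B3o (B3o + 1) Bo Jo (r - Jo) r').mul S (vBoBox S C F R k' r')) Jo)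

/-- [cite: Moore1966, Ch. 3 (interval arithmetic: inclusion property)] -/
theorem mem_psiJoBox (hS : 0 < S) (hks : PrimeData a ks) (hC : ConstsValid S a ks C) {F : FDConsts}
    (hF : FDValid S a F) {cd d0z Bo B3o Jo θn θd ηn ηd : ℕ} (hd0 : 0 < d0z) (hθn : 0 < θn) (hθd : 0 < θd)
    (hηn : 0 < ηn) (hηd : 0 < ηd) (hBo : 0 < Bo) (hB3 : 1 ≤ B3o) {k' r : ℕ} {R : IdxRec}
    (hR : OffValid S a ks ((k' : ℤ) + 1) R) :
    MI.mem S (psiJo a ((θn : ℝ) / θd) ((ηn : ℝ) / ηd) ((d0z : ℝ) * (1 / 2 ^ cd)) Bo B3o Jo k' r)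
      (psiJoBox S C F R cd d0z Bo B3o Jo θn θd ηn ηd k' r) := by
  have hπ : (π : ℝ) ≠ 0 := Real.pi_ne_zero
  have hθd' : (θd : ℝ) ≠ 0 := by exact_mod_cast hθd.ne'
  have hθn' : (θn : ℝ) ≠ 0 := by exact_mod_cast hθn.ne'
  have hηd' : (ηd : ℝ) ≠ 0 := by exact_mod_cast hηd.ne'
  have hηn' : (ηn : ℝ) ≠ 0 := by exact_mod_cast hηn.ne'
  have hd0' : (d0z : ℝ) ≠ 0 := by exact_mod_cast hd0.ne'
  have h2 : (2 : ℝ) ^ cd ≠ 0 := by positivity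
  have hpA : ∀ j, 1 ≤ pOA j := fun j ↦ by simp [pOA]
  have hpB : ∀ j, 1 ≤ pOB j := fun j ↦ by simp [pOB]
  have hcA : MI.mem S ((1 + (θn : ℝ) / θd) * (1 + (ηn : ℝ) / ηd) * (cAo a B3o ^ 2 / (π ^ 2 * ((d0z : ℝ) * (1 / 2 ^ cd)))))
      (((((cAoBox S C F B3o).sqr S).mul S F.invPi2).mulInt (((θd + θn) * (ηd + ηn) * 2 ^ cd : ℕ) : ℤ)).divNat
        (θd * ηd * d0z)) := by
    have h := MI.mem_divNat (MI.mem_mulInt (MI.mem_mul hS (MI.mem_sqr hS (mem_cAoBox hS hC hF B3o))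
      hF.invPi2) (((θd + θn) * (ηd + ηn) * 2 ^ cd : ℕ) : ℤ)) (n := θd * ηd * d0z) (by positivity)
    refine mem_of_eq h ?_
    push_cast
    field_simp
  have hcB : MI.mem S ((1 + (θn : ℝ) / θd) * (1 + ((ηn : ℝ) / ηd)⁻¹) * (1 / ((d0z : ℝ) * (1 / 2 ^ cd))))
      (((MI.ofInt S 1).mulInt (((θd + θn) * (ηn + ηd) * 2 ^ cd : ℕ) : ℤ)).divNat (θd * ηn * d0z)) := by
    have h := MI.mem_divNat (MI.mem_mulInt (MI.mem_ofInt S 1) (((θd + θn) * (ηn + ηd) * 2 ^ cd : ℕ) : ℤ))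
      (n := θd * ηn * d0z) (by positivity)
    refine mem_of_eq h ?_
    push_cast
    field_simp
  unfold psiJo psiJoBox
  split_ifs
  · exact MI.mem_mul hS hcA (mem_sumBox S Jo fun j' _ ↦
      MI.mem_mul hS (mem_hankHBox S hpA hB3 (by omega) hBo r j') (mem_vAoBox S k' j'))
  · exact MI.mem_mul hS hcB (mem_sumBox S Jo fun r' _ ↦
      MI.mem_mul hS (mem_hankHBox S hpB hB3 (by omega) hBo (r - Jo) r') (mem_vBoBox hS hks hC hF hR))

/-- Box of the diagonal `dg⁻(k)` (record of mode `k + 1`). [cite: Moore1966, Ch. 3 (interval arithmetic: inclusion property)] -/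
def dgJoBox (S : ℕ) (C : Consts) (F : FDConsts) (R : IdxRec) (cd d0z Bo B3o Jo θn θd : ℕ) (k : ℕ) : MI :=
  (((MI.ofInt S 1).mulInt (((θn + θd) * Bo * 2 ^ cd : ℕ) : ℤ)).divNat
      (θn * d0z * (4 * Jo + 1) * B3o ^ (4 * Jo + 1))).mul S ((rhoOBox S C F R Jo k).sqr S)

/-- [cite: Moore1966, Ch. 3 (interval arithmetic: inclusion property)] -/
theorem mem_dgJoBox (hS : 0 < S) (hC : ConstsValid S a ks C) {F : FDConsts} (hF : FDValid S a F)
    {cd d0z Bo B3o Jo θn θd : ℕ} (hd0 : 0 < d0z) (hθn : 0 < θn) (hθd : 0 < θd) (hB3 : 1 ≤ B3o) {k : ℕ} {R : IdxRec}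
    (hR : OffValid S a ks ((k : ℤ) + 1) R) :
    MI.mem S (dgJo a ((θn : ℝ) / θd) ((d0z : ℝ) * (1 / 2 ^ cd)) Bo B3o Jo k)
      (dgJoBox S C F R cd d0z Bo B3o Jo θn θd k) := by
  have hθd' : (θd : ℝ) ≠ 0 := by exact_mod_cast hθd.ne'
  have hθn' : (θn : ℝ) ≠ 0 := by exact_mod_cast hθn.ne'
  have hd0' : (d0z : ℝ) ≠ 0 := by exact_mod_cast hd0.ne'
  have h2 : (2 : ℝ) ^ cd ≠ 0 := by positivity
  have hcR : MI.mem S ((1 + ((θn : ℝ) / θd)⁻¹) * ((Bo : ℝ) / ((d0z : ℝ) * (1 / 2 ^ cd) *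
      ((4 * Jo + 1 : ℕ) * (B3o : ℝ) ^ (4 * Jo + 1)))))
      (((MI.ofInt S 1).mulInt (((θn + θd) * Bo * 2 ^ cd : ℕ) : ℤ)).divNat
        (θn * d0z * (4 * Jo + 1) * B3o ^ (4 * Jo + 1))) := by
    have h := MI.mem_divNat (MI.mem_mulInt (MI.mem_ofInt S 1) (((θn + θd) * Bo * 2 ^ cd : ℕ) : ℤ))
      (n := θn * d0z * (4 * Jo + 1) * B3o ^ (4 * Jo + 1)) (by positivity)
    refine mem_of_eq h ?_
    have hX' : ((B3o : ℕ) : ℝ) ≠ 0 := by exact_mod_cast (show 0 < B3o by omega).ne'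
    push_cast
    field_simp
  unfold dgJo dgJoBox
  exact MI.mem_mul hS hcR (MI.mem_sqr hS (mem_rhoOBox hS hC hF hR))

/-- `U₂⁻(k,k') = U₂⁻(k',k)`. [cite: Yoshida1992HermitianForms, §7 pp. 305–312] -/
theorem U2OddJ_comm (a θ η d0 : ℝ) (Bo B3o Jo k k' : ℕ) :
    U2OddJ a θ η d0 Bo B3o Jo k k' = U2OddJ a θ η d0 Bo B3o Jo k' k := by
  rw [← U2OddJ'_eq, ← U2OddJ'_eq]
  unfold U2OddJ'
  have hsA : ∑ j ∈ Finset.range Jo, ∑ j' ∈ Finset.range Jo, hankH pOA B3o (B3o + 1) Bo Jo j j' * vAo k j * vAo k' j'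
      = ∑ j ∈ Finset.range Jo, ∑ j' ∈ Finset.range Jo, hankH pOA B3o (B3o + 1) Bo Jo j j' * vAo k' j * vAo k j' := by
    rw [Finset.sum_comm]
    refine Finset.sum_congr rfl fun j _ ↦ Finset.sum_congr rfl fun j' _ ↦ ?_
    by_cases hjj : j' = j
    · subst hjj; ring
    · rw [hankH_comm _ _ _ _ _ _ _ hjj]; ring
  have hsB : ∑ r ∈ Finset.range Jo, ∑ r' ∈ Finset.range Jo, hankH pOB B3o (B3o + 1) Bo Jo r r' * vBo a k r * vBo a k' r'
      = ∑ r ∈ Finset.range Jo, ∑ r' ∈ Finset.range Jo, hankH pOB B3o (B3o + 1) Bo Jo r r' * vBo a k' r * vBo a k r' := by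
    rw [Finset.sum_comm]
    refine Finset.sum_congr rfl fun r _ ↦ Finset.sum_congr rfl fun r' _ ↦ ?_
    by_cases hrr : r' = r
    · subst hrr; ring
    · rw [hankH_comm _ _ _ _ _ _ _ hrr]; ring
  rw [hsA, hsB]
  by_cases hkk : k = k'
  · subst hkk; rfl
  · rw [if_neg hkk, if_neg (Ne.symm hkk)]

end Encl

end Literature.NumberTheory.LFunctions.Yoshida1992
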